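import Summits.QuantumFields.YangMills.Theorems.UnitScaleTiltFluctuationComparisonRegPrGlobalSlackKernelMatching
import HarnessLib

/-!
# `UnitScaleTiltFluctuationComparisonRegPrGlobalSlackKernelMatchingCompose` — THE K1a INTERFACE COMPOSES: six chart-calculus rows ⟹ the local slack row
# (crux `FluctuationComparisonRegPrL`, stmt-QuantumFields-19935, STUB 3⁗ `stub_globalTwoRunSlackFam`; width-lever lane A «order-σ matched height-free kernels»)

PORT, VERBATIM (§3–§3c), of the crux-ideate workfile `Cruxes/FluctuationComparisonRegPr/Sketch_ideator1_g12.lean` (seat ym-cruxidea-19201-1 g12, finding F-idea1-g12-1,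
crux writes 2026-08-27T11:35Z r1 7120b888e223 and 11:53Z r2 d164a4b6bba3) into the namespace `Summit.QuantumFields.YangMills.Theorems.GlobalSlackKernelMatching` (companion of `…GlobalSlackKernelMatching`, which
carries §0–§2: carriers and rows).  CREDIT: every declaration below is ym-cruxidea-19201-1 g12's; the porting seat (ym-ust-19935-slack g0) changed only this docstring,
the imports, the namespace, and `_`-prefixed three unused hypotheses of `jet_re_diff_ml` (tree lint; positions unchanged).

CONTENT.  §3 the algebra, PROVED: `per_order_ml` (one order: `‖Kt(B₁^d) − K(B₀^d)‖ ≤ s²·‖Kt − K‖-budget + 6st·‖K‖-budget`, `2 ≤ d ≤ 6`, via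
`ContinuousMultilinearMap.le_opNorm` + `norm_image_sub_le`), `norm_inv_factorial_le_one`, `taylor_core_ml` (orders 2..6 of `jet26` + vacuum constants + two
remainders at one `(K, n, j, V, Y)`).  §3b the composition, PROVED: `polymerCauchyMinAtTSlackW_of_charts` (`TaylorSplitΦ` + `FlatKernelCauchyΦ` (K1a) + `KernelSizeΦ`
+ `RemainderSmallΦ` + `CfgSizeΦ` + `CfgCauchyΦ` with loss `ℓ ≥ 1` ⟹ `PolymerCauchyMinAtTSlackW … 7 (5(C_s²C + 6C_sC_BC_E) + 2C_R) (θ(n)²ℓ(n))`, shifts `c := e′ − e`,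
on the window `(C_s + C_B)θ(n) ≤ 1`) and the row of record `polymerCauchyMinAtTSlack_of_charts` (`ℓ ≡ 1`) — the hypothesis of the local→global producer
`globalTwoRunSlackTail_of_polymerSlack` (sketch g11), whose output `GlobalSlack.GlobalSupRateTSlack` with `σ ≥ 7`, `C ≥ 0` is the tail of 3⁗.  §3c PURE-FIRST (r2; OWNER
RULING g20-№11 ADDENDUM 3 of record, ideator 2's N8): `PolySplitΦ` (`R ≡ 0`), `jet_re_diff_ml`, `polymerCauchyMinAtT_of_charts` (five rows ⟹ the socket's PURE row
`T3AlphaInputsACTwoRunLevel.PolymerCauchyMinAtT` BY NAME), `taylorSplit_of_polySplit`.  Nothing of [Balaban1985UV3]/[King1986] is asserted.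

References: C. King, CMP 102 (1986) 649–677 [King1986] (Thm 3.4 (3.9) p.656, (3.42) p.660, Prop. 3.6 (3.56)–(3.57) p.662, (3.72) p.665); T. Bałaban, CMP 102 (1985)
255–275 [Balaban1985UV3] ((30) p.263, (43)–(44) pp.266–267, (57) p.270).
-/

set_option autoImplicit false

noncomputable section

open scoped BigOperators
open Literature.MathematicalPhysics.QuantumFieldTheory.Balaban1983to89
open Literature.MathematicalPhysics.QuantumFieldTheory.Balaban1983to89.T3ContinuumYM3Torus
open Literature.MathematicalPhysics.QuantumFieldTheory.Balaban1983to89.T3UnitScaleTilt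
open Literature.MathematicalPhysics.QuantumFieldTheory.Balaban1983to89.T3LevelShift
open Literature.MathematicalPhysics.QuantumFieldTheory.Balaban1983to89.T3AlphaInputsAC
open Literature.MathematicalPhysics.QuantumFieldTheory.Balaban1983to89.T3AlphaPolymerSocket
open Literature.MathematicalPhysics.QuantumFieldTheory.Balaban1983to89.T3AlphaInputsACTwoRun
open Literature.MathematicalPhysics.QuantumFieldTheory.Balaban1983to89.T3AlphaInputsACTwoRunLevel
open Summit.QuantumFields.Balaban3D.Proofs.Representation33 (jet26)

namespace Summit.QuantumFields.YangMills.Theorems.GlobalSlackKernelMatching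

/-! ## §3 The algebra of the chart calculus (proved) -/

section Algebra

/-- **ONE ORDER**: `‖Kt(B₁,…,B₁) − K(B₀,…,B₀)‖ ≤ s²·‖Kt − K‖-budget + 6·s·t·‖K‖-budget` for `2 ≤ d ≤ 6`, `‖B₀‖, ‖B₁‖ ≤ s ≤ 1`, `‖B₁ − B₀‖ ≤ t`
(`ContinuousMultilinearMap.le_opNorm` + `norm_image_sub_le`). [cite: King1986, (3.56)-(3.57) p.662] -/
theorem per_order_ml {E : Type*} [NormedAddCommGroup E] [NormedSpace ℂ E] {d : ℕ} (hd2 : 2 ≤ d) (hd6 : d ≤ 6)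
    (Kr Kt : ContinuousMultilinearMap ℂ (fun _ : Fin d => E) ℂ) (B₀ B₁ : E)
    {s t e ρ C C_E : ℝ} (hs0 : 0 ≤ s) (hs1 : s ≤ 1) (ht : 0 ≤ t)
    (hB₀ : ‖B₀‖ ≤ s) (hB₁ : ‖B₁‖ ≤ s) (hΔ : ‖B₁ - B₀‖ ≤ t)
    (hK : ‖Kt - Kr‖ ≤ C * e * ρ) (hE : ‖Kr‖ ≤ C_E * e) :
    ‖Kt (fun _ => B₁) - Kr (fun _ => B₀)‖ ≤ s ^ 2 * (C * e * ρ) + 6 * s * t * (C_E * e) := by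
  have hKnn : 0 ≤ C * e * ρ := (norm_nonneg _).trans hK
  have hEnn : 0 ≤ C_E * e := (norm_nonneg _).trans hE
  have split : Kt (fun _ => B₁) - Kr (fun _ => B₀) =
      (Kt - Kr) (fun _ => B₁) + (Kr (fun _ => B₁) - Kr (fun _ => B₀)) := by
    rw [show (Kt - Kr) (fun _ => B₁) = Kt (fun _ => B₁) - Kr (fun _ => B₁) from rfl]; ring
  have h1 : ‖(Kt - Kr) (fun _ => B₁)‖ ≤ s ^ 2 * (C * e * ρ) := by
    calc ‖(Kt - Kr) (fun _ => B₁)‖ ≤ ‖Kt - Kr‖ * ∏ _l : Fin d, ‖B₁‖ := (Kt - Kr).le_opNorm _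
      _ = ‖Kt - Kr‖ * ‖B₁‖ ^ d := by rw [Finset.prod_const, Finset.card_univ, Fintype.card_fin]
      _ ≤ (C * e * ρ) * s ^ d := mul_le_mul hK (pow_le_pow_left₀ (norm_nonneg _) hB₁ d) (by positivity) hKnn
      _ ≤ (C * e * ρ) * s ^ 2 := mul_le_mul_of_nonneg_left (pow_le_pow_of_le_one hs0 hs1 hd2) hKnn
      _ = _ := by ring
  have h2 : ‖Kr (fun _ => B₁) - Kr (fun _ => B₀)‖ ≤ 6 * s * t * (C_E * e) := by
    have hle := Kr.norm_image_sub_le (fun _ : Fin d => B₁) (fun _ => B₀)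
    rw [Fintype.card_fin] at hle
    have hm : max ‖(fun _ : Fin d => B₁)‖ ‖(fun _ : Fin d => B₀)‖ ≤ s :=
      max_le ((pi_norm_const_le B₁).trans hB₁) ((pi_norm_const_le B₀).trans hB₀)
    have hm0 : 0 ≤ max ‖(fun _ : Fin d => B₁)‖ ‖(fun _ : Fin d => B₀)‖ := (norm_nonneg _).trans (le_max_left _ _)
    have hsub : ((fun _ : Fin d => B₁) - fun _ : Fin d => B₀) = fun _ => B₁ - B₀ := rfl
    have hdiff : ‖(fun _ : Fin d => B₁) - fun _ : Fin d => B₀‖ ≤ t := by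
      rw [hsub]; exact (pi_norm_const_le (B₁ - B₀)).trans hΔ
    have hA : ‖Kr‖ * (d : ℝ) ≤ C_E * e * 6 := mul_le_mul hE (by exact_mod_cast hd6) (Nat.cast_nonneg d) hEnn
    have hB : max ‖(fun _ : Fin d => B₁)‖ ‖(fun _ : Fin d => B₀)‖ ^ (d - 1) ≤ s ^ (d - 1) := pow_le_pow_left₀ hm0 hm (d - 1)
    have hsd : s ^ (d - 1) ≤ s := by
      have h' : s ^ (d - 1) ≤ s ^ 1 := pow_le_pow_of_le_one hs0 hs1 (by omega)
      rwa [pow_one] at h'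
    calc ‖Kr (fun _ => B₁) - Kr (fun _ => B₀)‖
        ≤ ‖Kr‖ * (d : ℝ) * max ‖(fun _ : Fin d => B₁)‖ ‖(fun _ : Fin d => B₀)‖ ^ (d - 1) *
            ‖(fun _ : Fin d => B₁) - fun _ : Fin d => B₀‖ := hle
      _ ≤ C_E * e * 6 * s ^ (d - 1) * t :=
          mul_le_mul (mul_le_mul hA hB (pow_nonneg hm0 _) (by positivity)) hdiff (norm_nonneg _) (by positivity)
      _ ≤ C_E * e * 6 * s * t := by
          have h6 : 0 ≤ C_E * e * 6 := by positivity
          exact mul_le_mul_of_nonneg_right (mul_le_mul_of_nonneg_left hsd h6) ht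
      _ = _ := by ring
  rw [split]
  exact (norm_add_le _ _).trans (add_le_add h1 h2)

/-- `‖(d!)⁻¹‖ ≤ 1` in `ℂ`. [folklore] -/
theorem norm_inv_factorial_le_one (d : ℕ) : ‖((d.factorial : ℂ))⁻¹‖ ≤ 1 := by
  rw [norm_inv, Complex.norm_natCast]
  exact inv_le_one_of_one_le₀ (by exact_mod_cast Nat.succ_le_of_lt (Nat.factorial_pos d))

/-- **THE TAYLOR CORE (orders 2..6 of `jet26` + vacuum constants + two remainders), chart calculus**: the composition of the six rows at one `(K, n, j, V, Y)`.
[cite: King1986, Prop. 3.6 (3.56)-(3.57) p.662; Balaban1985UV3, (30) p.263] -/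
theorem taylor_core_ml {E₀ E₁ : Type*} [NormedAddCommGroup E₀] [NormedSpace ℂ E₀] [NormedAddCommGroup E₁] [NormedSpace ℂ E₁]
    (T : E₀ →L[ℂ] E₁) (Ψ₀ : E₀ → ℂ) (Ψ₁ : E₁ → ℂ) (B₀ B₁ : E₀) (e₀ e₁ R₀ R₁ : ℝ)
    {θ x ρ e C C_E C_R C_s C_B : ℝ}
    (hθ : 0 ≤ θ) (hsθ : C_s * θ ≤ 1) (hx0 : 0 ≤ x) (hx1 : x ≤ 1) (hρ : 0 ≤ ρ) (he : 0 ≤ e)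
    (hC : 0 ≤ C) (hCE : 0 ≤ C_E) (hCR : 0 ≤ C_R) (hCs : 0 ≤ C_s) (hCB : 0 ≤ C_B)
    (hB₀ : ‖B₀‖ ≤ C_s * θ * x ^ 2) (hB₁ : ‖B₁‖ ≤ C_s * θ * x ^ 2) (hΔ : ‖B₁ - B₀‖ ≤ C_B * θ * x ^ 2 * ρ)
    (hK : ∀ d ∈ Finset.Ico 2 7,
      ‖(iteratedFDeriv ℂ d Ψ₁ 0).compContinuousLinearMap (fun _ => T) - iteratedFDeriv ℂ d Ψ₀ 0‖ ≤ C * e * ρ)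
    (hE : ∀ d ∈ Finset.Ico 2 7, ‖iteratedFDeriv ℂ d Ψ₀ 0‖ ≤ C_E * e)
    (hR₀ : |R₀| ≤ C_R * e * θ ^ 7 * x ^ 4) (hR₁ : |R₁| ≤ C_R * e * θ ^ 7 * x ^ 4) :
    |e₁ + (jet26 Ψ₁ (T B₁)).re + R₁ - (e₀ + (jet26 Ψ₀ B₀).re + R₀) - (e₁ - e₀)| ≤
      (5 * (C_s ^ 2 * C + 6 * C_s * C_B * C_E) + 2 * C_R) * e * x ^ 4 * (θ ^ 2 * ρ + θ ^ 7) := by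
  have hx2 : x ^ 2 ≤ 1 := pow_le_one₀ hx0 hx1
  have hs0 : 0 ≤ C_s * θ * x ^ 2 := by positivity
  have hs1 : C_s * θ * x ^ 2 ≤ 1 := by
    calc C_s * θ * x ^ 2 ≤ 1 * 1 := mul_le_mul hsθ hx2 (by positivity) zero_le_one
      _ = 1 := one_mul 1
  have ht0 : 0 ≤ C_B * θ * x ^ 2 * ρ := by positivity
  -- the jet difference, order by order
  have hper : ∀ d ∈ Finset.Ico 2 7,
      ‖iteratedFDeriv ℂ d Ψ₁ 0 (fun _ => T B₁) - iteratedFDeriv ℂ d Ψ₀ 0 (fun _ => B₀)‖ ≤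
        (C_s * θ * x ^ 2) ^ 2 * (C * e * ρ) + 6 * (C_s * θ * x ^ 2) * (C_B * θ * x ^ 2 * ρ) * (C_E * e) := by
    intro d hd
    have hd' := Finset.mem_Ico.mp hd
    have happ : iteratedFDeriv ℂ d Ψ₁ 0 (fun _ => T B₁) =
        ((iteratedFDeriv ℂ d Ψ₁ 0).compContinuousLinearMap fun _ => T) (fun _ => B₁) := by
      rw [ContinuousMultilinearMap.compContinuousLinearMap_apply]
    rw [happ]
    exact per_order_ml hd'.1 (by omega) (iteratedFDeriv ℂ d Ψ₀ 0) _ B₀ B₁ hs0 hs1 ht0 hB₀ hB₁ hΔ (hK d hd) (hE d hd)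
  have hjet : ‖jet26 Ψ₁ (T B₁) - jet26 Ψ₀ B₀‖ ≤
      ∑ d ∈ Finset.Ico 2 7, ‖iteratedFDeriv ℂ d Ψ₁ 0 (fun _ => T B₁) - iteratedFDeriv ℂ d Ψ₀ 0 (fun _ => B₀)‖ := by
    unfold jet26
    rw [← Finset.sum_sub_distrib]
    refine (norm_sum_le _ _).trans (Finset.sum_le_sum fun d _ => ?_)
    rw [← smul_sub, norm_smul]
    calc ‖((d.factorial : ℂ))⁻¹‖ * ‖iteratedFDeriv ℂ d Ψ₁ 0 (fun _ => T B₁) - iteratedFDeriv ℂ d Ψ₀ 0 (fun _ => B₀)‖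
        ≤ 1 * ‖iteratedFDeriv ℂ d Ψ₁ 0 (fun _ => T B₁) - iteratedFDeriv ℂ d Ψ₀ 0 (fun _ => B₀)‖ :=
          mul_le_mul_of_nonneg_right (norm_inv_factorial_le_one d) (norm_nonneg _)
      _ = _ := one_mul _
  have hre : |(jet26 Ψ₁ (T B₁)).re - (jet26 Ψ₀ B₀).re| ≤
      ∑ d ∈ Finset.Ico 2 7, ((C_s * θ * x ^ 2) ^ 2 * (C * e * ρ) + 6 * (C_s * θ * x ^ 2) * (C_B * θ * x ^ 2 * ρ) * (C_E * e)) := by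
    rw [← Complex.sub_re]
    exact ((Complex.abs_re_le_norm _).trans hjet).trans (Finset.sum_le_sum hper)
  have hcard : (Finset.Ico 2 7).card = 5 := by rfl
  rw [Finset.sum_const, hcard, nsmul_eq_mul] at hre
  push_cast at hre
  have eq : e₁ + (jet26 Ψ₁ (T B₁)).re + R₁ - (e₀ + (jet26 Ψ₀ B₀).re + R₀) - (e₁ - e₀) =
      ((jet26 Ψ₁ (T B₁)).re - (jet26 Ψ₀ B₀).re) + (R₁ - R₀) := by ring
  rw [eq]
  have hM : 0 ≤ C_s ^ 2 * C + 6 * C_s * C_B * C_E :=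
    add_nonneg (mul_nonneg (sq_nonneg _) hC) (mul_nonneg (mul_nonneg (mul_nonneg (by norm_num) hCs) hCB) hCE)
  have hθ7 : 0 ≤ θ ^ 7 := pow_nonneg hθ 7
  have hRR : |R₁ - R₀| ≤ C_R * e * θ ^ 7 * x ^ 4 + C_R * e * θ ^ 7 * x ^ 4 :=
    (abs_sub R₁ R₀).trans (add_le_add hR₁ hR₀)
  calc |(jet26 Ψ₁ (T B₁)).re - (jet26 Ψ₀ B₀).re + (R₁ - R₀)|
      ≤ |(jet26 Ψ₁ (T B₁)).re - (jet26 Ψ₀ B₀).re| + |R₁ - R₀| := abs_add_le _ _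
    _ ≤ 5 * ((C_s * θ * x ^ 2) ^ 2 * (C * e * ρ) + 6 * (C_s * θ * x ^ 2) * (C_B * θ * x ^ 2 * ρ) * (C_E * e)) +
          (C_R * e * θ ^ 7 * x ^ 4 + C_R * e * θ ^ 7 * x ^ 4) := add_le_add hre hRR
    _ = 5 * (C_s ^ 2 * C + 6 * C_s * C_B * C_E) * e * x ^ 4 * (θ ^ 2 * ρ) + 2 * C_R * e * θ ^ 7 * x ^ 4 := by ring
    _ ≤ (5 * (C_s ^ 2 * C + 6 * C_s * C_B * C_E) + 2 * C_R) * e * x ^ 4 * (θ ^ 2 * ρ + θ ^ 7) := by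
          have hA : 0 ≤ 5 * (C_s ^ 2 * C + 6 * C_s * C_B * C_E) * e * x ^ 4 * θ ^ 7 := by positivity
          have hB : 0 ≤ 2 * C_R * e * x ^ 4 * (θ ^ 2 * ρ) := by positivity
          nlinarith [hA, hB]

end Algebra

/-! ### §3b The line's composition over the rows (proved) -/

section Composition

variable {𝕍 : Type} [NormedAddCommGroup 𝕍] [NormedSpace ℂ 𝕍] {F : T3Family} {γ : ℝ}

/-- **THE K1a INTERFACE COMPOSES (FIRST CHECKABLE STATEMENT, PROVED) — weighted form.**  Taylor structure over ONE chart family + flat-kernel Cauchy in operator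
norm (K1a) + kernel size + remainder + configuration size + configuration Cauchy with loss `ℓ ≥ 1` ⟹ the local two-cut-off row with slack `σ = 7` and rate
weight `w n = θ(n)²·ℓ(n)`, shifts `c := e′ − e` (vacuum constants), constant `5·(C_s²C + 6C_sC_BC_E) + 2C_R`, on a window with `(C_s + C_B)·θ(n) ≤ 1`.
[cite: King1986, Prop. 3.6 p.662, (3.42) p.660, (3.72) p.665; Balaban1985UV3, (30) p.263, (43)-(44) pp.266-267, (57) p.270] -/
theorem polymerCauchyMinAtTSlackW_of_charts {D : AlphaDataT3 F γ} {PT : TermFn F} {Φ : ChartFam 𝕍 F} {e : VacFam F} {B : CfgFam 𝕍 F}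
    {R : RemFam F} {b₀ p₀ κ a C C_E C_R C_s C_B : ℝ} {ℓ : ℕ → ℝ}
    (hC : 0 ≤ C) (hCE : 0 ≤ C_E) (hCR : 0 ≤ C_R) (hCs : 0 ≤ C_s) (hCB : 0 ≤ C_B) (hL : 1 ≤ (F.L : ℝ))
    (hθ0 : ∀ n, 0 ≤ θBal F.L γ b₀ p₀ n) (hθ1 : ∀ n, (C_s + C_B) * θBal F.L γ b₀ p₀ n ≤ 1) (hℓ : ∀ n, 1 ≤ ℓ n)
    (hT : TaylorSplitΦ PT Φ e B R) (hK : FlatKernelCauchyΦ D Φ κ a C) (hE : KernelSizeΦ D Φ κ C_E)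
    (hR : RemainderSmallΦ D R b₀ p₀ κ C_R) (hS : CfgSizeΦ D B b₀ p₀ C_s) (hBC : CfgCauchyΦ D B b₀ p₀ a C_B ℓ) :
    PolymerCauchyMinAtTSlackW D PT b₀ p₀ κ a 7 (5 * (C_s ^ 2 * C + 6 * C_s * C_B * C_E) + 2 * C_R)
      (fun n => θBal F.L γ b₀ p₀ n ^ 2 * ℓ n) := by
  refine ⟨fun K _ j Y => e (K + 1) (j + 1) (refineSet F K Y) - e K j Y, ?_⟩
  intro K n hn j hj V hV Y hY
  have hSz := hS K n hn j hj V hV Y hY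
  have hCy := hBC K n hn j hj V hV Y hY
  have hRm := hR K n hn j hj V hV Y hY
  have hEs := hE K (K - n) j Y hY
  rw [hT, hT]
  have hsθ : C_s * θBal F.L γ b₀ p₀ n ≤ 1 := by nlinarith [hθ1 n, hθ0 n]
  have hx0 : 0 ≤ ((F.L : ℝ) ^ (K - n - 1 - j))⁻¹ := by positivity
  have hx1 : ((F.L : ℝ) ^ (K - n - 1 - j))⁻¹ ≤ 1 := inv_le_one_of_one_le₀ (one_le_pow₀ hL)
  have hρ0 : 0 ≤ (((F.L : ℝ) ^ (1 + j))⁻¹) ^ a := Real.rpow_nonneg (by positivity) _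
  have hρ : 0 ≤ ℓ n * (((F.L : ℝ) ^ (1 + j))⁻¹) ^ a := mul_nonneg (zero_le_one.trans (hℓ n)) hρ0
  -- the loss-free kernel row implies the lossy one (`ℓ ≥ 1`)
  have hKc : ∀ d ∈ Finset.Ico 2 7, ‖kerT Φ K j Y d - ker Φ K j Y d‖ ≤
      C * Real.exp (-κ * D.treeLen K (1 + j) Y) * (ℓ n * (((F.L : ℝ) ^ (1 + j))⁻¹) ^ a) := by
    intro d hd
    refine (hK K (K - n) j Y hY d hd).trans ?_
    have hCe : 0 ≤ C * Real.exp (-κ * D.treeLen K (1 + j) Y) := mul_nonneg hC (Real.exp_pos _).le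
    calc C * Real.exp (-κ * D.treeLen K (1 + j) Y) * (((F.L : ℝ) ^ (1 + j))⁻¹) ^ a
        = C * Real.exp (-κ * D.treeLen K (1 + j) Y) * (1 * (((F.L : ℝ) ^ (1 + j))⁻¹) ^ a) := by rw [one_mul]
      _ ≤ C * Real.exp (-κ * D.treeLen K (1 + j) Y) * (ℓ n * (((F.L : ℝ) ^ (1 + j))⁻¹) ^ a) :=
          mul_le_mul_of_nonneg_left (mul_le_mul_of_nonneg_right (hℓ n) hρ0) hCe
  -- run `K+1`'s configuration is the transport of its pull-back
  set B₁ : PBond (F.P K) j → 𝕍 := fun c => B (K + 1) (K + 1 - n) (j + 1) (refineSet F K Y)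
    (fieldShift (F.sitesPerDir_eq (m := F.m) (K := K + 1) (j := K + 1 - n) (m' := F.m) (K' := n) (j' := 0) (by omega)) V)
    (matchBond F K j c) with hB₁
  have hpull : B (K + 1) (K + 1 - n) (j + 1) (refineSet F K Y)
      (fieldShift (F.sitesPerDir_eq (m := F.m) (K := K + 1) (j := K + 1 - n) (m' := F.m) (K' := n) (j' := 0) (by omega)) V) =
      transport 𝕍 F K j B₁ := (transport_pullback K j _).symm
  rw [hpull]
  have key := taylor_core_ml (transport 𝕍 F K j) (Φ K j Y) (Φ (K + 1) (j + 1) (refineSet F K Y)) _ B₁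
    (e K j Y) (e (K + 1) (j + 1) (refineSet F K Y)) _ _
    (hθ0 n) hsθ hx0 hx1 hρ (Real.exp_pos _).le hC hCE hCR hCs hCB hSz.1 hSz.2 hCy hKc hEs hRm.1 hRm.2
  -- reassociate `θ² * (ℓ * ρ₀)` as `(θ² * ℓ) * ρ₀`
  simpa only [mul_assoc] using key

/-- **THE ROW OF RECORD (loss-free configuration comparison, `ℓ ≡ 1`)**: the six rows ⟹ `PolymerCauchyMinAtTSlack D PT b₀ p₀ κ a 7 (5(C_s²C + 6C_sC_BC_E) + 2C_R)`
VERBATIM — feeds g11's `globalTwoRunSlackTail_of_polymerSlack` (with `PintDecompTrivT`, `LocCover`, `LocBlockVolume`, `LocMatched`, `TermSizeTrivT` of the same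
`(π, PT)`) ⟹ `∃ σ₀ C₀, 7 ≤ σ₀ ∧ 0 ≤ C₀ ∧ GlobalSupRateTSlack …` = the tail of STUB 3⁗ (and, by `GlobalSlackBeta.slackB_of_slack`, of its β-form).
[cite: King1986, Prop. 3.6 p.662, Thm 3.4 (3.9) p.656; Balaban1985UV3, (30) p.263, (43)-(44) pp.266-267, (57) p.270] -/
theorem polymerCauchyMinAtTSlack_of_charts {D : AlphaDataT3 F γ} {PT : TermFn F} {Φ : ChartFam 𝕍 F} {e : VacFam F} {B : CfgFam 𝕍 F}
    {R : RemFam F} {b₀ p₀ κ a C C_E C_R C_s C_B : ℝ}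
    (hC : 0 ≤ C) (hCE : 0 ≤ C_E) (hCR : 0 ≤ C_R) (hCs : 0 ≤ C_s) (hCB : 0 ≤ C_B) (hL : 1 ≤ (F.L : ℝ))
    (hθ0 : ∀ n, 0 ≤ θBal F.L γ b₀ p₀ n) (hθ1 : ∀ n, (C_s + C_B) * θBal F.L γ b₀ p₀ n ≤ 1)
    (hT : TaylorSplitΦ PT Φ e B R) (hK : FlatKernelCauchyΦ D Φ κ a C) (hE : KernelSizeΦ D Φ κ C_E)
    (hR : RemainderSmallΦ D R b₀ p₀ κ C_R) (hS : CfgSizeΦ D B b₀ p₀ C_s) (hBC : CfgCauchyΦ D B b₀ p₀ a C_B fun _ => 1) :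
    PolymerCauchyMinAtTSlack D PT b₀ p₀ κ a 7 (5 * (C_s ^ 2 * C + 6 * C_s * C_B * C_E) + 2 * C_R) := by
  obtain ⟨c, hc⟩ := polymerCauchyMinAtTSlackW_of_charts hC hCE hCR hCs hCB hL hθ0 hθ1 (fun _ => le_rfl) hT hK hE hR hS hBC
  exact ⟨c, fun K n hn j hj V hV Y hY => by simpa only [mul_one] using hc K n hn j hj V hV Y hY⟩

end Composition

/-! ### §3c PURE-FIRST (OWNER RULING g20-№11 ADDENDUM 3, of record: print's (43) activities are EXACT degree-2..6 polynomials, `R ≡ 0`; ideator 2's N8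
`polymerCauchyMinAtT_of_polySplit` in scalar currency) — the same interface yields the PURE row of record `T3AlphaInputsACTwoRunLevel.PolymerCauchyMinAtT` BY NAME
in the multilinear currency (append-only r2: nothing above is changed). -/

section Pure

variable {𝕍 : Type} [NormedAddCommGroup 𝕍] [NormedSpace ℂ 𝕍] {F : T3Family} {γ : ℝ}

/-- **POLYNOMIAL STRUCTURE ROW** (`TaylorSplitΦ` with `R ≡ 0`): the term IS the vacuum constant plus the retained jet — print's (33)/(43) read literally (N8.1/N8.2),
with `Φ` the near-truncated displayed chart polynomial. [cite: Balaban1985UV3, (33)-(34) p.264, (43) p.266] -/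
def PolySplitΦ (PT : TermFn F) (Φ : ChartFam 𝕍 F) (e : VacFam F) (B : CfgFam 𝕍 F) : Prop :=
  ∀ (K k b : ℕ) (Y : Set (Site (F.P K) 0)) (W : GaugeField (F.P K) k (Matrix.specialUnitaryGroup (Fin 2) ℂ)),
    PT K k (1 + b) Y W = e K b Y + (jet26 (Φ K b Y) (B K k b Y W)).re

/-- The retained-jet difference alone (no rest): `|Re jet26 Ψ₁ (T B₁) − Re jet26 Ψ₀ B₀| ≤ 5(C_s²C + 6C_sC_BC_E)·e·x⁴·θ²·ρ`. [cite: King1986, Prop. 3.6 p.662; Balaban1985UV3, (43)-(44) pp.266-267] -/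
theorem jet_re_diff_ml {E₀ E₁ : Type*} [NormedAddCommGroup E₀] [NormedSpace ℂ E₀] [NormedAddCommGroup E₁] [NormedSpace ℂ E₁]
    (T : E₀ →L[ℂ] E₁) (Ψ₀ : E₀ → ℂ) (Ψ₁ : E₁ → ℂ) (B₀ B₁ : E₀)
    {θ x ρ e C C_E C_s C_B : ℝ}
    (hθ : 0 ≤ θ) (hsθ : C_s * θ ≤ 1) (hx0 : 0 ≤ x) (hx1 : x ≤ 1) (hρ : 0 ≤ ρ) (_he : 0 ≤ e)
    (_hC : 0 ≤ C) (_hCE : 0 ≤ C_E) (hCs : 0 ≤ C_s) (hCB : 0 ≤ C_B)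
    (hB₀ : ‖B₀‖ ≤ C_s * θ * x ^ 2) (hB₁ : ‖B₁‖ ≤ C_s * θ * x ^ 2) (hΔ : ‖B₁ - B₀‖ ≤ C_B * θ * x ^ 2 * ρ)
    (hK : ∀ d ∈ Finset.Ico 2 7,
      ‖(iteratedFDeriv ℂ d Ψ₁ 0).compContinuousLinearMap (fun _ => T) - iteratedFDeriv ℂ d Ψ₀ 0‖ ≤ C * e * ρ)
    (hE : ∀ d ∈ Finset.Ico 2 7, ‖iteratedFDeriv ℂ d Ψ₀ 0‖ ≤ C_E * e) :
    |(jet26 Ψ₁ (T B₁)).re - (jet26 Ψ₀ B₀).re| ≤ 5 * (C_s ^ 2 * C + 6 * C_s * C_B * C_E) * e * x ^ 4 * (θ ^ 2 * ρ) := by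
  have hx2 : x ^ 2 ≤ 1 := pow_le_one₀ hx0 hx1
  have hs0 : 0 ≤ C_s * θ * x ^ 2 := by positivity
  have hs1 : C_s * θ * x ^ 2 ≤ 1 := by
    calc C_s * θ * x ^ 2 ≤ 1 * 1 := mul_le_mul hsθ hx2 (by positivity) zero_le_one
      _ = 1 := one_mul 1
  have ht0 : 0 ≤ C_B * θ * x ^ 2 * ρ := by positivity
  have hper : ∀ d ∈ Finset.Ico 2 7,
      ‖iteratedFDeriv ℂ d Ψ₁ 0 (fun _ => T B₁) - iteratedFDeriv ℂ d Ψ₀ 0 (fun _ => B₀)‖ ≤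
        (C_s * θ * x ^ 2) ^ 2 * (C * e * ρ) + 6 * (C_s * θ * x ^ 2) * (C_B * θ * x ^ 2 * ρ) * (C_E * e) := by
    intro d hd
    have hd' := Finset.mem_Ico.mp hd
    have happ : iteratedFDeriv ℂ d Ψ₁ 0 (fun _ => T B₁) =
        ((iteratedFDeriv ℂ d Ψ₁ 0).compContinuousLinearMap fun _ => T) (fun _ => B₁) := by
      rw [ContinuousMultilinearMap.compContinuousLinearMap_apply]
    rw [happ]
    exact per_order_ml hd'.1 (by omega) (iteratedFDeriv ℂ d Ψ₀ 0) _ B₀ B₁ hs0 hs1 ht0 hB₀ hB₁ hΔ (hK d hd) (hE d hd)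
  have hjet : ‖jet26 Ψ₁ (T B₁) - jet26 Ψ₀ B₀‖ ≤
      ∑ d ∈ Finset.Ico 2 7, ‖iteratedFDeriv ℂ d Ψ₁ 0 (fun _ => T B₁) - iteratedFDeriv ℂ d Ψ₀ 0 (fun _ => B₀)‖ := by
    unfold jet26
    rw [← Finset.sum_sub_distrib]
    refine (norm_sum_le _ _).trans (Finset.sum_le_sum fun d _ => ?_)
    rw [← smul_sub, norm_smul]
    calc ‖((d.factorial : ℂ))⁻¹‖ * ‖iteratedFDeriv ℂ d Ψ₁ 0 (fun _ => T B₁) - iteratedFDeriv ℂ d Ψ₀ 0 (fun _ => B₀)‖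
        ≤ 1 * ‖iteratedFDeriv ℂ d Ψ₁ 0 (fun _ => T B₁) - iteratedFDeriv ℂ d Ψ₀ 0 (fun _ => B₀)‖ :=
          mul_le_mul_of_nonneg_right (norm_inv_factorial_le_one d) (norm_nonneg _)
      _ = _ := one_mul _
  have hre : |(jet26 Ψ₁ (T B₁)).re - (jet26 Ψ₀ B₀).re| ≤
      ∑ d ∈ Finset.Ico 2 7, ((C_s * θ * x ^ 2) ^ 2 * (C * e * ρ) + 6 * (C_s * θ * x ^ 2) * (C_B * θ * x ^ 2 * ρ) * (C_E * e)) := by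
    rw [← Complex.sub_re]
    exact ((Complex.abs_re_le_norm _).trans hjet).trans (Finset.sum_le_sum hper)
  have hcard : (Finset.Ico 2 7).card = 5 := by rfl
  rw [Finset.sum_const, hcard, nsmul_eq_mul] at hre
  push_cast at hre
  exact hre.trans (le_of_eq (by ring))

/-- **PURE-FIRST COMPOSITION (PROVED): the five rows (no rest, no loss) ⟹ the socket's PURE per-polymer row of record `PolymerCauchyMinAtT D PT b₀ p₀ κ a
(5(C_s²C + 6C_sC_BC_E))` BY NAME** — OWNER RULING g20-№11 ADDENDUM 3's line «K1a + CfgCauchy + sizes ⟹ PolymerCauchyMinAtT ⟹ slack_of_pure ⟹ g11 producer ⟹ 3⁗» in the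
multilinear currency; shifts `c := e′ − e`; window `(C_s + C_B)·θ(n) ≤ 1`. [cite: King1986, Prop. 3.6 p.662, Thm 3.4 (3.9) p.656; Balaban1985UV3, (33)-(34) p.264, (43)-(44) pp.266-267] -/
theorem polymerCauchyMinAtT_of_charts {D : AlphaDataT3 F γ} {PT : TermFn F} {Φ : ChartFam 𝕍 F} {e : VacFam F} {B : CfgFam 𝕍 F}
    {b₀ p₀ κ a C C_E C_s C_B : ℝ}
    (hC : 0 ≤ C) (hCE : 0 ≤ C_E) (hCs : 0 ≤ C_s) (hCB : 0 ≤ C_B) (hL : 1 ≤ (F.L : ℝ))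
    (hθ0 : ∀ n, 0 ≤ θBal F.L γ b₀ p₀ n) (hθ1 : ∀ n, (C_s + C_B) * θBal F.L γ b₀ p₀ n ≤ 1)
    (hP : PolySplitΦ PT Φ e B) (hK : FlatKernelCauchyΦ D Φ κ a C) (hE : KernelSizeΦ D Φ κ C_E)
    (hS : CfgSizeΦ D B b₀ p₀ C_s) (hBC : CfgCauchyΦ D B b₀ p₀ a C_B fun _ => 1) :
    PolymerCauchyMinAtT D PT b₀ p₀ κ a (5 * (C_s ^ 2 * C + 6 * C_s * C_B * C_E)) := by
  refine ⟨fun K _ j Y => e (K + 1) (j + 1) (refineSet F K Y) - e K j Y, ?_⟩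
  intro K n hn j hj V hV Y hY
  have hSz := hS K n hn j hj V hV Y hY
  have hCy := hBC K n hn j hj V hV Y hY
  have hEs := hE K (K - n) j Y hY
  rw [hP, hP]
  have hsθ : C_s * θBal F.L γ b₀ p₀ n ≤ 1 := by nlinarith [hθ1 n, hθ0 n]
  have hx0 : 0 ≤ ((F.L : ℝ) ^ (K - n - 1 - j))⁻¹ := by positivity
  have hx1 : ((F.L : ℝ) ^ (K - n - 1 - j))⁻¹ ≤ 1 := inv_le_one_of_one_le₀ (one_le_pow₀ hL)
  have hρ0 : 0 ≤ (((F.L : ℝ) ^ (1 + j))⁻¹) ^ a := Real.rpow_nonneg (by positivity) _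
  set B₁ : PBond (F.P K) j → 𝕍 := fun c => B (K + 1) (K + 1 - n) (j + 1) (refineSet F K Y)
    (fieldShift (F.sitesPerDir_eq (m := F.m) (K := K + 1) (j := K + 1 - n) (m' := F.m) (K' := n) (j' := 0) (by omega)) V)
    (matchBond F K j c) with hB₁
  have hpull : B (K + 1) (K + 1 - n) (j + 1) (refineSet F K Y)
      (fieldShift (F.sitesPerDir_eq (m := F.m) (K := K + 1) (j := K + 1 - n) (m' := F.m) (K' := n) (j' := 0) (by omega)) V) =
      transport 𝕍 F K j B₁ := (transport_pullback K j _).symm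
  rw [hpull]
  have hΔ : ‖B₁ - B K (K - n) j Y
      (fieldShift (F.sitesPerDir_eq (m := F.m) (K := K) (j := K - n) (m' := F.m) (K' := n) (j' := 0) (by omega)) V)‖ ≤
      C_B * θBal F.L γ b₀ p₀ n * (((F.L : ℝ) ^ (K - n - 1 - j))⁻¹) ^ 2 * (((F.L : ℝ) ^ (1 + j))⁻¹) ^ a := by
    simpa only [one_mul] using hCy
  have key := jet_re_diff_ml (transport 𝕍 F K j) (Φ K j Y) (Φ (K + 1) (j + 1) (refineSet F K Y)) _ B₁
    (hθ0 n) hsθ hx0 hx1 hρ0 (Real.exp_pos _).le hC hCE hCs hCB hSz.1 hSz.2 hΔ (hK K (K - n) j Y hY) hEs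
  have eq : e (K + 1) (j + 1) (refineSet F K Y) + (jet26 (Φ (K + 1) (j + 1) (refineSet F K Y)) (transport 𝕍 F K j B₁)).re -
      (e K j Y + (jet26 (Φ K j Y) (B K (K - n) j Y
        (fieldShift (F.sitesPerDir_eq (m := F.m) (K := K) (j := K - n) (m' := F.m) (K' := n) (j' := 0) (by omega)) V))).re) -
      (e (K + 1) (j + 1) (refineSet F K Y) - e K j Y) =
      (jet26 (Φ (K + 1) (j + 1) (refineSet F K Y)) (transport 𝕍 F K j B₁)).re -
      (jet26 (Φ K j Y) (B K (K - n) j Y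
        (fieldShift (F.sitesPerDir_eq (m := F.m) (K := K) (j := K - n) (m' := F.m) (K' := n) (j' := 0) (by omega)) V))).re := by ring
  rw [eq]
  exact key.trans (le_of_eq (by ring))

/-- `PolySplitΦ` is `TaylorSplitΦ` with the zero rest (so the slack compositions of §3b apply to a pure-first record too, `C_R = 0`). [folklore] -/
theorem taylorSplit_of_polySplit {PT : TermFn F} {Φ : ChartFam 𝕍 F} {e : VacFam F} {B : CfgFam 𝕍 F} (h : PolySplitΦ PT Φ e B) :
    TaylorSplitΦ PT Φ e B (fun _ _ _ _ _ => 0) := by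
  intro K k b Y W
  rw [h, add_zero]

end Pure

end Summit.QuantumFields.YangMills.Theorems.GlobalSlackKernelMatching

end
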